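import Summits.QuantumFields.YangMills.Theorems.FemtoTransferGapRungW1upSite

/-!
# Femto transfer gap — rung W1-up, part 5/7: the ball and annulus profiles and their volumes

Support module of the `FemtoTransferGap` group (cell `ym-beyond`, seat P1; route `LuscherReduction`, crux `OneSiteLevels` =
`stmt-QuantumFields-20007`), part 5/7 of the sorry-free proof of the registered BC5 rung `RungUpperK1` (`stub_rungW1up`):
`∃ C B0, ∀ B ≥ B0, e^{−C λ_b(B)} λ₀(B,1) ≤ λ₁(B,1)` on the ONE-SITE lattice (`rungUpperK1` in `FemtoTransferGapRungW1up`).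

The two one-link profiles of width `r`: the BALL profile `profA r = clamp(2 − 2 vacDist/r)` (`= 1` on `vacDist ≤ r/2`, `= 0` off
`vacDist < r`, `(2/r)`-Lipschitz) and the ANNULUS profile `profB r` (supported in `2r < vacDist < 3r`, `= 1` on `[9r/4, 11r/4]`,
`(4/r)`-Lipschitz): class functions, centre-invariant, disjoint and `r`-separated supports; volume bounds `∫ profA² ≥ ballVol(r/4)`,
`∫ profB² ≥ ballVol(r/4)` (`r ≤ 4/5`), `∫ profA ≤ 2 ballVol r ≤ 2·5¹⁶ ballVol(r/4)`, `ballVol(3r) ≤ 5³² ballVol(r/4)`.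

## WHAT THIS IS NOT
NOT THE CLAY GAP; no statement about `L → ∞` or a continuum limit.  Everything below is proved (no `sorry`, no new axiom).
-/

set_option autoImplicit false

noncomputable section

open MeasureTheory Filter Topology Real
open scoped Matrix ComplexConjugate
open Literature.MathematicalPhysics.QuantumFieldTheory
open Literature.MathematicalPhysics.QuantumLattice

namespace Summit.QuantumFields.YangMills.Theorems.FemtoTransferGap

/-! ## Part D. The trial states and the lower bound for `λ₁(B, 1)`

One-link profiles of width `r` (later `r = λ_b(B) = (2/B)^{1/3}`): the BALL profile `g_a = clamp(2 − 2·vacDist/r)` (equal to `1` on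
`vacDist ≤ r/2`, supported in `vacDist < r`, `(2/r)`-Lipschitz) and the ANNULUS profile `g_b = clamp(min(4(vacDist/r − 2), 4(3 − vacDist/r)))`
(equal to `1` on `9r/4 ≤ vacDist ≤ 11r/4`, supported in `2r < vacDist < 3r`, `(4/r)`-Lipschitz).  The two physical product states are
`a = ⊗ₑ g_a` and `b = g_b ⊗ (⊗_{e ≠ e₀} g_a)`; they are orthogonal with disjoint supports, and the trial state orthogonal to a given
physical `φ` is `ψ = ⟨b,φ⟩ a − ⟨a,φ⟩ b` (or `a` itself when `⟨a,φ⟩ = 0`). -/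

/-! ### D.1 Profiles -/

/-- Clamp to `[0,1]`. [folklore] -/
def clamp01 (x : ℝ) : ℝ := max 0 (min 1 x)

/-- `0 ≤ clamp01 x`. [folklore] -/
theorem clamp01_nonneg (x : ℝ) : 0 ≤ clamp01 x := le_max_left _ _

/-- `clamp01 x ≤ 1`. [folklore] -/
theorem clamp01_le_one (x : ℝ) : clamp01 x ≤ 1 := max_le zero_le_one (min_le_left _ _)

/-- `clamp01 x = 1` for `x ≥ 1`. [folklore] -/
theorem clamp01_of_one_le {x : ℝ} (h : 1 ≤ x) : clamp01 x = 1 := by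
  unfold clamp01; rw [min_eq_left h, max_eq_right zero_le_one]

/-- `clamp01 x = 0` for `x ≤ 0`. [folklore] -/
theorem clamp01_of_nonpos {x : ℝ} (h : x ≤ 0) : clamp01 x = 0 := by
  unfold clamp01; exact max_eq_left ((min_le_right _ _).trans h)

/-- `clamp01 x ≠ 0 ⇒ 0 < x`. [folklore] -/
theorem pos_of_clamp01_ne_zero {x : ℝ} (h : clamp01 x ≠ 0) : 0 < x := by
  by_contra hx; exact h (clamp01_of_nonpos (not_lt.mp hx))

/-- `clamp01` is `1`-Lipschitz. [folklore] -/
theorem abs_clamp01_sub_le (x y : ℝ) : |clamp01 x - clamp01 y| ≤ |x - y| := by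
  unfold clamp01
  calc |max 0 (min 1 x) - max 0 (min 1 y)| ≤ max |(0 : ℝ) - 0| |min 1 x - min 1 y| := abs_max_sub_max_le_max _ _ _ _
    _ ≤ max |(0 : ℝ) - 0| (max |(1 : ℝ) - 1| |x - y|) := max_le_max le_rfl (abs_min_sub_min_le_max _ _ _ _)
    _ = |x - y| := by simp

/-- `clamp01` is continuous. [folklore] -/
theorem continuous_clamp01 : Continuous clamp01 := continuous_const.max (continuous_const.min continuous_id)

/-- **Ball profile** `g_a(W) = clamp(2 − 2 vacDist(W)/r)`. [folklore] -/
def profA (r : ℝ) (W : SU2) : ℝ := clamp01 (2 - 2 * (vacDist W / r))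

/-- **Annulus profile** `g_b(W) = clamp(min(4(vacDist(W)/r − 2), 4(3 − vacDist(W)/r)))`. [folklore] -/
def profB (r : ℝ) (W : SU2) : ℝ := clamp01 (min (4 * (vacDist W / r - 2)) (4 * (3 - vacDist W / r)))

/-- `0 ≤ g_a ≤ 1`. [folklore] -/
theorem profA_nonneg (r : ℝ) (W : SU2) : 0 ≤ profA r W := clamp01_nonneg _

/-- `g_a ≤ 1`. [folklore] -/
theorem profA_le_one (r : ℝ) (W : SU2) : profA r W ≤ 1 := clamp01_le_one _

/-- `0 ≤ g_b`. [folklore] -/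
theorem profB_nonneg (r : ℝ) (W : SU2) : 0 ≤ profB r W := clamp01_nonneg _

/-- `g_b ≤ 1`. [folklore] -/
theorem profB_le_one (r : ℝ) (W : SU2) : profB r W ≤ 1 := clamp01_le_one _

/-- `g_a` is continuous. [folklore] -/
theorem continuous_profA (r : ℝ) : Continuous (profA r) :=
  continuous_clamp01.comp (continuous_const.sub (continuous_const.mul (continuous_vacDist.div_const r)))

/-- `g_b` is continuous. [folklore] -/
theorem continuous_profB (r : ℝ) : Continuous (profB r) :=
  continuous_clamp01.comp ((continuous_const.mul ((continuous_vacDist.div_const r).sub continuous_const)).min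
    (continuous_const.mul (continuous_const.sub (continuous_vacDist.div_const r))))

/-- `g_a` is a class function. [folklore] -/
theorem profA_conj (r : ℝ) (g W : SU2) : profA r (g * W * g⁻¹) = profA r W := by simp only [profA, vacDist_conj]

/-- `g_b` is a class function. [folklore] -/
theorem profB_conj (r : ℝ) (g W : SU2) : profB r (g * W * g⁻¹) = profB r W := by simp only [profB, vacDist_conj]

/-- `g_a` is centre-symmetric. [folklore] -/
theorem profA_center (r : ℝ) {z : SU2} (hz : z ∈ Subgroup.center SU2) (W : SU2) : profA r (z * W) = profA r W := by
  simp only [profA, vacDist_center_mul hz]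

/-- `g_b` is centre-symmetric. [folklore] -/
theorem profB_center (r : ℝ) {z : SU2} (hz : z ∈ Subgroup.center SU2) (W : SU2) : profB r (z * W) = profB r W := by
  simp only [profB, vacDist_center_mul hz]

/-- Support of `g_a`: `g_a(W) ≠ 0 ⇒ vacDist W < r`. [folklore] -/
theorem vacDist_lt_of_profA_ne_zero {r : ℝ} (hr : 0 < r) {W : SU2} (h : profA r W ≠ 0) : vacDist W < r := by
  have h2 := pos_of_clamp01_ne_zero h
  have : vacDist W / r < 1 := by linarith
  rwa [div_lt_one hr] at this

/-- `g_a = 1` on `vacDist ≤ r/2`. [folklore] -/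
theorem profA_eq_one {r : ℝ} (hr : 0 < r) {W : SU2} (h : vacDist W ≤ r / 2) : profA r W = 1 := by
  apply clamp01_of_one_le
  have : vacDist W / r ≤ 1 / 2 := by rw [div_le_iff₀ hr]; linarith
  linarith

/-- `g_a` vanishes off `{vacDist ≤ r}`. [folklore] -/
theorem profA_eq_zero_off {r : ℝ} (hr : 0 < r) (W : SU2) (hW : W ∉ {W : SU2 | vacDist W ≤ r}) : profA r W = 0 := by
  by_contra h
  exact hW (le_of_lt (vacDist_lt_of_profA_ne_zero hr h))

/-- Support of `g_b`: `g_b(W) ≠ 0 ⇒ 2r < vacDist W < 3r`. [folklore] -/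
theorem vacDist_of_profB_ne_zero {r : ℝ} (hr : 0 < r) {W : SU2} (h : profB r W ≠ 0) :
    2 * r < vacDist W ∧ vacDist W < 3 * r := by
  have h2 := pos_of_clamp01_ne_zero h
  rw [lt_min_iff] at h2
  obtain ⟨h3, h4⟩ := h2
  have h5 : 2 < vacDist W / r := by linarith
  have h6 : vacDist W / r < 3 := by linarith
  rw [lt_div_iff₀ hr] at h5
  rw [div_lt_iff₀ hr] at h6
  exact ⟨h5, h6⟩

/-- `g_b = 1` on `9r/4 ≤ vacDist ≤ 11r/4`. [folklore] -/
theorem profB_eq_one {r : ℝ} (hr : 0 < r) {W : SU2} (h1 : 9 / 4 * r ≤ vacDist W) (h2 : vacDist W ≤ 11 / 4 * r) :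
    profB r W = 1 := by
  apply clamp01_of_one_le
  have h3 : 9 / 4 ≤ vacDist W / r := by rw [le_div_iff₀ hr]; linarith
  have h4 : vacDist W / r ≤ 11 / 4 := by rw [div_le_iff₀ hr]; linarith
  exact le_min (by linarith) (by linarith)

/-- `g_b` vanishes off `{vacDist ≤ 3r}`. [folklore] -/
theorem profB_eq_zero_off {r : ℝ} (hr : 0 < r) (W : SU2) (hW : W ∉ {W : SU2 | vacDist W ≤ 3 * r}) : profB r W = 0 := by
  by_contra h
  exact hW (le_of_lt (vacDist_of_profB_ne_zero hr h).2)

/-- `g_b = 0` on `vacDist ≤ 2r`. [folklore] -/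
theorem profB_eq_zero_of_le {r : ℝ} (hr : 0 < r) {W : SU2} (hW : vacDist W ≤ 2 * r) : profB r W = 0 := by
  by_contra h
  have := (vacDist_of_profB_ne_zero hr h).1
  linarith

/-- `g_a` is `(2/r)`-Lipschitz for the Frobenius distance. [folklore] -/
theorem profA_lipschitz {r : ℝ} (hr : 0 < r) (u v : SU2) :
    |profA r u - profA r v| ≤ 2 / r * frobNorm ((u : Matrix (Fin 2) (Fin 2) ℂ) - (v : Matrix (Fin 2) (Fin 2) ℂ)) := by
  unfold profA
  calc |clamp01 (2 - 2 * (vacDist u / r)) - clamp01 (2 - 2 * (vacDist v / r))|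
      ≤ |(2 - 2 * (vacDist u / r)) - (2 - 2 * (vacDist v / r))| := abs_clamp01_sub_le _ _
    _ = 2 / r * |vacDist u - vacDist v| := by
        rw [show (2 - 2 * (vacDist u / r)) - (2 - 2 * (vacDist v / r)) = -(2 / r * (vacDist u - vacDist v)) by ring,
          abs_neg, abs_mul, abs_of_pos (by positivity)]
    _ ≤ 2 / r * frobNorm ((u : Matrix (Fin 2) (Fin 2) ℂ) - (v : Matrix (Fin 2) (Fin 2) ℂ)) :=
        mul_le_mul_of_nonneg_left (abs_vacDist_sub_le u v) (by positivity)

/-- `g_b` is `(4/r)`-Lipschitz for the Frobenius distance. [folklore] -/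
theorem profB_lipschitz {r : ℝ} (hr : 0 < r) (u v : SU2) :
    |profB r u - profB r v| ≤ 4 / r * frobNorm ((u : Matrix (Fin 2) (Fin 2) ℂ) - (v : Matrix (Fin 2) (Fin 2) ℂ)) := by
  unfold profB
  have e1 : 4 * (vacDist u / r - 2) - 4 * (vacDist v / r - 2) = 4 / r * (vacDist u - vacDist v) := by ring
  have e2 : 4 * (3 - vacDist u / r) - 4 * (3 - vacDist v / r) = -(4 / r * (vacDist u - vacDist v)) := by ring
  calc |clamp01 (min (4 * (vacDist u / r - 2)) (4 * (3 - vacDist u / r))) -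
        clamp01 (min (4 * (vacDist v / r - 2)) (4 * (3 - vacDist v / r)))|
      ≤ |min (4 * (vacDist u / r - 2)) (4 * (3 - vacDist u / r)) - min (4 * (vacDist v / r - 2)) (4 * (3 - vacDist v / r))| :=
        abs_clamp01_sub_le _ _
    _ ≤ max |4 * (vacDist u / r - 2) - 4 * (vacDist v / r - 2)| |4 * (3 - vacDist u / r) - 4 * (3 - vacDist v / r)| :=
        abs_min_sub_min_le_max _ _ _ _
    _ = 4 / r * |vacDist u - vacDist v| := by
        rw [e1, e2, abs_neg, max_self, abs_mul, abs_of_pos (by positivity)]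
    _ ≤ 4 / r * frobNorm ((u : Matrix (Fin 2) (Fin 2) ℂ) - (v : Matrix (Fin 2) (Fin 2) ℂ)) :=
        mul_le_mul_of_nonneg_left (abs_vacDist_sub_le u v) (by positivity)

/-- Disjoint supports: `g_a g_b = 0`. [folklore] -/
theorem profA_mul_profB {r : ℝ} (hr : 0 < r) (W : SU2) : profA r W * profB r W = 0 := by
  by_cases h : profA r W = 0
  · rw [h, zero_mul]
  · have hd := vacDist_lt_of_profA_ne_zero hr h
    rw [profB_eq_zero_of_le hr (by linarith), mul_zero]

/-- Separated supports: `g_a(u) ≠ 0`, `g_b(v) ≠ 0 ⇒ ‖u − v‖_F ≥ r`. [folklore] -/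
theorem profA_profB_sep {r : ℝ} (hr : 0 < r) (u v : SU2) (hu : profA r u ≠ 0) (hv : profB r v ≠ 0) :
    r ≤ frobNorm ((u : Matrix (Fin 2) (Fin 2) ℂ) - (v : Matrix (Fin 2) (Fin 2) ℂ)) := by
  have h1 := vacDist_lt_of_profA_ne_zero hr hu
  have h2 := (vacDist_of_profB_ne_zero hr hv).1
  have h3 := abs_vacDist_sub_le u v
  rw [abs_le] at h3
  linarith [h3.1]

/-- Separated supports, mirrored. [folklore] -/
theorem profB_profA_sep {r : ℝ} (hr : 0 < r) (u v : SU2) (hu : profB r u ≠ 0) (hv : profA r v ≠ 0) :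
    r ≤ frobNorm ((u : Matrix (Fin 2) (Fin 2) ℂ) - (v : Matrix (Fin 2) (Fin 2) ℂ)) := by
  rw [frobNorm_sub_comm]; exact profA_profB_sep hr v u hv hu

/-! ### D.2 Volumes of the profiles -/

/-- The closed Frobenius ball about `W₀` is measurable. [folklore] -/
theorem measurableSet_frobBall (W₀ : SU2) (ρ : ℝ) :
    MeasurableSet {W : SU2 | frobNorm ((W : Matrix (Fin 2) (Fin 2) ℂ) - (W₀ : Matrix (Fin 2) (Fin 2) ℂ)) ≤ ρ} :=
  (isClosed_le (continuous_frobNorm'.comp (continuous_subtype_val.sub continuous_const)) continuous_const).measurableSet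

/-- A continuous `[0,1]`-valued function (or its square) is integrable on `SU(2)`. [folklore] -/
theorem integrable_of_unitInterval {g : SU2 → ℝ} (hg : Continuous g) (h0 : ∀ u, 0 ≤ g u) (h1 : ∀ u, g u ≤ 1) (n : ℕ) :
    Integrable (fun u => g u ^ n) (haarProbability SU2) := by
  refine integrable_of_measurable_abs_le _ (hg.measurable.pow_const n) (C := 1) fun u => ?_
  rw [abs_pow, abs_of_nonneg (h0 u)]; exact pow_le_one₀ (h0 u) (h1 u)

/-- `∫ g_a² ≥ ballVol(r/4)`. [folklore] -/
theorem ballVol_le_integral_profA_sq {r : ℝ} (hr : 0 < r) :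
    ballVol (r / 4) ≤ ∫ u, profA r u ^ 2 ∂haarProbability SU2 := by
  have hS := measurableSet_frobBall 1 (r / 4)
  simp only [OneMemClass.coe_one] at hS
  have h1 : ballVol (r / 4) = ∫ u, ({W : SU2 | frobNorm ((W : Matrix (Fin 2) (Fin 2) ℂ) - 1) ≤ r / 4}).indicator 1 u
      ∂haarProbability SU2 := (integral_indicator_one hS).symm
  rw [h1]
  refine integral_mono ((integrable_const (1 : ℝ)).indicator hS) (integrable_of_unitInterval (continuous_profA r)
    (profA_nonneg r) (profA_le_one r) 2) fun u => ?_
  by_cases hu : u ∈ {W : SU2 | frobNorm ((W : Matrix (Fin 2) (Fin 2) ℂ) - 1) ≤ r / 4}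
  · rw [Set.indicator_of_mem hu]
    have hd : vacDist u ≤ r / 2 := (vacDist_le_sub_one u).trans (by simp only [Set.mem_setOf_eq] at hu; linarith)
    simp [profA_eq_one hr hd]
  · rw [Set.indicator_of_notMem hu]; positivity

/-- `∫ g_b² ≥ ballVol(r/4)` (`r ≤ 4/5`, so that the annulus `vacDist = 5r/2` is inhabited). [folklore] -/
theorem ballVol_le_integral_profB_sq {r : ℝ} (hr : 0 < r) (hr1 : r ≤ 4 / 5) :
    ballVol (r / 4) ≤ ∫ u, profB r u ^ 2 ∂haarProbability SU2 := by
  obtain ⟨W₀, hW₀, -⟩ := exists_vacDist_eq (t := 5 / 2 * r) (by positivity) (by linarith)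
  have hS := measurableSet_frobBall W₀ (r / 4)
  rw [← ballVol_shift W₀ (r / 4), show (haarProbability SU2).real
      {W : SU2 | frobNorm ((W : Matrix (Fin 2) (Fin 2) ℂ) - (W₀ : Matrix (Fin 2) (Fin 2) ℂ)) ≤ r / 4} =
      ∫ u, ({W : SU2 | frobNorm ((W : Matrix (Fin 2) (Fin 2) ℂ) - (W₀ : Matrix (Fin 2) (Fin 2) ℂ)) ≤ r / 4}).indicator 1 u
        ∂haarProbability SU2 from (integral_indicator_one hS).symm]
  refine integral_mono ((integrable_const (1 : ℝ)).indicator hS) (integrable_of_unitInterval (continuous_profB r)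
    (profB_nonneg r) (profB_le_one r) 2) fun u => ?_
  by_cases hu : u ∈ {W : SU2 | frobNorm ((W : Matrix (Fin 2) (Fin 2) ℂ) - (W₀ : Matrix (Fin 2) (Fin 2) ℂ)) ≤ r / 4}
  · rw [Set.indicator_of_mem hu]
    have h3 := abs_vacDist_sub_le u W₀
    simp only [Set.mem_setOf_eq] at hu
    rw [abs_le, hW₀] at h3
    have := profB_eq_one hr (W := u) (by linarith [h3.1]) (by linarith [h3.2])
    simp [this]
  · rw [Set.indicator_of_notMem hu]; positivity

/-- `∫ g_a ≤ σ{vacDist ≤ r} ≤ 2 ballVol r`. [folklore] -/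
theorem integral_profA_le {r : ℝ} (hr : 0 < r) : ∫ u, profA r u ∂haarProbability SU2 ≤ 2 * ballVol r := by
  have hS := measurableSet_vacDist_le r
  refine le_trans ?_ (vacSet_real_le r)
  rw [← integral_indicator_one hS]
  refine integral_mono ?_ ((integrable_const (1 : ℝ)).indicator hS) fun u => ?_
  · have := integrable_of_unitInterval (continuous_profA r) (profA_nonneg r) (profA_le_one r) 1
    simpa using this
  · by_cases hu : u ∈ {W : SU2 | vacDist W ≤ r}
    · rw [Set.indicator_of_mem hu]; exact profA_le_one r u
    · rw [Set.indicator_of_notMem hu, profA_eq_zero_off hr u hu]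

/-- `ballVol r ≤ 5^{16} ballVol(r/4)`. [folklore] -/
theorem ballVol_le_of_quarter {r : ℝ} (hr : 0 ≤ r) : ballVol r ≤ 5 ^ 16 * ballVol (r / 4) := by
  have h := ballVol_pow_mul_le (r := r / 4) (by positivity) 2
  have e : (2 : ℝ) ^ 2 * (r / 4) = r := by ring
  rw [e] at h
  calc ballVol r ≤ (5 ^ 8) ^ 2 * ballVol (r / 4) := h
    _ = 5 ^ 16 * ballVol (r / 4) := by norm_num

/-- `ballVol (3r) ≤ 5^{32} ballVol(r/4)`. [folklore] -/
theorem ballVol_three_le_of_quarter {r : ℝ} (hr : 0 ≤ r) : ballVol (3 * r) ≤ 5 ^ 32 * ballVol (r / 4) := by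
  have h := ballVol_pow_mul_le (r := r / 4) (by positivity) 4
  have e : (2 : ℝ) ^ 4 * (r / 4) = 4 * r := by ring
  rw [e] at h
  calc ballVol (3 * r) ≤ ballVol (4 * r) := ballVol_mono (by linarith)
    _ ≤ (5 ^ 8) ^ 4 * ballVol (r / 4) := h
    _ = 5 ^ 32 * ballVol (r / 4) := by norm_num

end Summit.QuantumFields.YangMills.Theorems.FemtoTransferGap

end
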